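/-
PORT (pub-hodgecm2, COR-CM cell; count-neutral own lane PERL34-DISCHARGE, seat prover-pub-hodgecm2-b26-g22-0, 2026-08-21) of the stage-1
package file `HodgeCMPerL/HodgeCM/Prior/Perl34.lean` (pub-hodgecm HOME/lean, bytes of record md5 a2455d388f0d, 1862 lines), SECTION C3a =
its lines 695–944: [PerL] v5 Lemma 3.3(a) (lem:allowed(a), tex ll. 280–298), the Φ′(σ) = Ψ_i BRIDGE: CM types as choice functions
`B → Bool`, exponent patterns `mOf`, the set `Phiprime m` of (eq:Phiprime) with the A-lemma `Phiprime_eq_typeSet` ∕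
`inftyType_iff_Phiprime`, the AX2 character layer `C3a.CharLayer B V`, the allowed-datum interface `C3a.AllowedDatum L Ψ iota1`
(AX3/AX4 content as FIELDS), the sign dichotomy `mSign_injective` ∕ `mSignInv`, and Lemma 3.3(a) itself
`AllowedDatum.lem_allowed_a` (re-exported by the package as `HodgeCM.StubTree.lemma33a`, `StubTree/PerLProof.lean:72`).
Mathlib-only (consumes no field of the isolation interface).  Declarations and proofs VERBATIM; edits: this header, outer namespace
token `HodgeCM.Prior.Perl34File` ↦ `Summit.HodgeConjecture.CorCM.Prior.Perl34File`, ONE linter fix (unreachable `<;> omega` after a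
closing `simp_all` dropped in the private `mem_aux`).  Package
consumers: `StubTree/PerLProof.lean` (`lemma33a`), `PerL34/AllowedA.lean`, `PerL34/AllowedData.lean`.  FRAMING: HC_CM is NOT proved;
the statements concern abstract sign/exponent bookkeeping and assert nothing about any model.
-/
import Mathlib

namespace Summit.HodgeConjecture.CorCM.Prior.Perl34File

/-! # C3a = Lemma 3.3(a) (lem:allowed(a), [PerL] v5 ll. 280–298) — the Φ′(σ) = Ψ_i bridge

S4 tranche (plan v2 @e3be098b, C3a row; amendment A#7).  Byte-identical prefix =
S3/IsolationSetting.lean FROZEN @2def0917 (verified by `cmp` in S4/README.md); the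
prefix is carried for chain uniformity — C3a itself consumes no frozen field, it is
the σ-level bridge consumed by C3 (u_j ∈ U_{t^j}) and C6 ((H2)/(H3)).

Inputs, per the plan's C3a row, all axiom-group content as STRUCTURE FIELDS (no
`axiom` keyword): AX4 (+ convention pin), AX2 (uniqueness of μ(σ) off Satake),
AX3 (local components quotients of the local Weil representations; sign dichotomy
incl. the HKS pin |m(s)| = 1 [A#3]), A3(v) shape (one value m(s), m(−s) = −m(s));
PROVED here: the A-lemma "μ_i‖·‖^{−1/2} of infinity type −Σ_{ρ∈Ψ_i}ρ ⟺ exponent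
pattern (eq:Phiprime) = Ψ_i" (ll. 270–274, 296 with 98–100), injectivity/inversion
of the sign dichotomy, and Lemma 3.3(a) itself from the fields.
-/

namespace Perl34
namespace C3a

/-! ## The A-lemma: CM types, exponent patterns, (eq:Phiprime)

Conventions (docstring-pinned, matching [PerL] ll. 96–100 and A1's `Fin g → Bool`
encoding): `B` is the set of real places of L₀ = pairs of conjugate embeddings of
the CM field L; the embedding ρ_b is `(b, false)`, its conjugate ρ̄_b is `(b, true)`.
A CM type Ψ (one member of each conjugate pair) is the choice function `B → Bool`
with `Ψ b = false` ⟺ ρ_b ∈ Ψ. -/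

/-- An embedding of L over the place `b : B`: `(b, false)` = ρ_b, `(b, true)` = ρ̄_b. -/
abbrev Emb (B : Type) := B × Bool

/-- The set of embeddings of the CM type coded by `Ψ : B → Bool` (`Ψ b = false` ⟺
ρ_b ∈ Ψ). -/
def typeSet {B : Type} (Ψ : B → Bool) : Set (Emb B) := {e | e.2 = Ψ e.1}

/-- (eq:Phiprime), [PerL] ll. 98–100: for an exponent function m with values in {±1},
`Φ′(m) := {ρ_b : m_b = −1} ∪ {ρ̄_b : m_b = +1}`. -/
def Phiprime {B : Type} (m : B → ℤ) : Set (Emb B) :=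
  {e | (e.2 = false ∧ m e.1 = -1) ∨ (e.2 = true ∧ m e.1 = 1)}

/-- The exponent pattern of a CM type: m_b(Ψ) = −1 iff ρ_b ∈ Ψ (i.e. Ψ b = false),
+1 iff ρ̄_b ∈ Ψ.  ([PerL] l. 472–478 with [Y1neg] §3.) -/
def mOf {B : Type} (Ψ : B → Bool) : B → ℤ := fun b => if Ψ b then 1 else -1

/-- (no docstring in the 2001 source) -/
theorem mOf_unit {B : Type} (Ψ : B → Bool) (b : B) : mOf Ψ b = 1 ∨ mOf Ψ b = -1 := by
  cases hΨ : Ψ b <;> simp [mOf, hΨ]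

/-- "μ‖·‖^{−1/2} is algebraic of infinity type −Σ_{ρ∈Ψ}ρ" at the place b, in exponent
coordinates (Def 3.2, ll. 270–274): the unitary component (z/|z|)^{m_b} times
|z|^{−1} equals z^p z̄^q with p − q = m_b, p + q = −1, and (p, q) = (−1, 0) if
ρ_b ∈ Ψ, (0, −1) if ρ̄_b ∈ Ψ. -/
def InftyTypeAt {B : Type} (Ψ : B → Bool) (m : B → ℤ) (b : B) : Prop :=
  ∃ p q : ℤ, p - q = m b ∧ p + q = -1 ∧
    ((Ψ b = false ∧ p = -1 ∧ q = 0) ∨ (Ψ b = true ∧ p = 0 ∧ q = -1))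

/-- Dictionary, function form: the infinity-type condition at every place is exactly
the exponent pattern m = mOf Ψ. -/
theorem inftyType_iff_mOf {B : Type} (Ψ : B → Bool) (m : B → ℤ) :
    (∀ b, InftyTypeAt Ψ m b) ↔ m = mOf Ψ := by
  constructor
  · intro h
    funext b
    rcases h b with ⟨p, q, hpq, hsum, hcase⟩
    rcases hcase with ⟨hb, hp, hq⟩ | ⟨hb, hp, hq⟩ <;> subst hp hq <;>
      simp only [mOf, hb, if_false, if_true, Bool.false_eq_true] <;> omega
  · rintro rfl b
    cases hΨ : Ψ b
    · exact ⟨-1, 0, by simp [mOf, hΨ], by ring, Or.inl ⟨hΨ, rfl, rfl⟩⟩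
    · exact ⟨0, -1, by simp [mOf, hΨ], by ring, Or.inr ⟨hΨ, rfl, rfl⟩⟩

/-- (no docstring in the 2001 source) -/
private theorem mem_aux (c ψ : Bool) (x : ℤ) (hx : x = if ψ then 1 else -1) :
    ((c = false ∧ x = -1) ∨ (c = true ∧ x = 1)) ↔ (c = ψ) := by
  cases ψ <;> cases c <;> simp_all

/-- If m has the exponent pattern of Ψ then Φ′(m) is (the embedding set of) Ψ. -/
theorem Phiprime_eq_typeSet {B : Type} (Ψ : B → Bool) (m : B → ℤ)
    (h : ∀ b, m b = mOf Ψ b) : Phiprime m = typeSet Ψ := by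
  ext ⟨b, c⟩
  simp only [Phiprime, typeSet, Set.mem_setOf_eq]
  exact mem_aux c (Ψ b) (m b) (h b)

/-- **The A-lemma of plan C3a** ([PerL] l. 296 with ll. 270–274, 98–100):
"μ‖·‖^{−1/2} of infinity type −Σ_{ρ∈Ψ}ρ" ⟺ the exponent pattern (eq:Phiprime)
of m is Ψ.  (No {±1} hypothesis: the set equality itself forces m_b ∈ {±1},
place by place, so the lemma is stated in the strongest form.) -/
theorem inftyType_iff_Phiprime {B : Type} (Ψ : B → Bool) (m : B → ℤ) :
    (∀ b, InftyTypeAt Ψ m b) ↔ Phiprime m = typeSet Ψ := by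
  rw [inftyType_iff_mOf]
  constructor
  · rintro rfl
    exact Phiprime_eq_typeSet Ψ _ fun _ => rfl
  · intro h
    funext b
    show m b = if Ψ b then 1 else -1
    cases hΨ : Ψ b
    · have hmem : (b, false) ∈ Phiprime m := by
        rw [h]; show (false : Bool) = Ψ b; exact hΨ.symm
      rcases hmem with ⟨_, hm1⟩ | ⟨hc, _⟩
      · simpa using hm1
      · exact absurd hc (by simp)
    · have hmem : (b, true) ∈ Phiprime m := by
        rw [h]; show (true : Bool) = Ψ b; exact hΨ.symm
      rcases hmem with ⟨hc, _⟩ | ⟨_, hm1⟩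
      · exact absurd hc (by simp)
      · simpa using hm1
/-! ## The AX2 character layer and the allowed-datum interface -/

/-- **AX2 layer** ([PerL] ll. 96–100 via [Y1neg] Lemma 4.1): a bare type of unitary
Hecke characters of L, their complex-place exponents m_b(·), a local-agreement
relation at the finite places, and the rigidity "read off the Satake parameters"
(l. 96 `unique`): two characters agreeing at almost all finite places coincide.
`AlmostAll` is the abstract "at almost every finite place" collection (monotone;
the concrete cofinite filter stays semantic, D1). -/
structure CharLayer (B V : Type) where
  /-- unitary Hecke characters of L (bare index type). -/
  Char : Type
  /-- AX2: the exponents m_b(·) ∈ ℤ at the complex places (ll. 96–97; values in {±1}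
  for the characters attached to 𝒜^{1,0}, carried where consumed). -/
  mExp : Char → B → ℤ
  /-- the set of finite places where two Hecke characters have equal unramified local
  components (equal Satake data). -/
  locEq : Char → Char → Set V
  /-- "at almost all finite places" (contains-a-cofinite-set collection; bare). -/
  AlmostAll : Set V → Prop
  /-- monotonicity of `AlmostAll`. -/
  almostAll_mono : ∀ {s t : Set V}, s ⊆ t → AlmostAll s → AlmostAll t
  /-- AX2 rigidity: characters agreeing at almost all finite places are equal
  ("there is a unique unitary Hecke character μ(π) read off the Satake parameters",
  l. 96; [Y1neg] Lemma 4.1). -/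
  AX2_rigid : ∀ χ χ' : Char, AlmostAll (locEq χ χ') → χ = χ'

/-- **One allowed datum** (W_i, μ_i, χ′_i) of type Ψ_i with the constituent layer of
the L²-closure of its theta space π_i = Θ^{W_i}_{μ_i}(χ′_i), at the plan's C3a
abstraction (Def 3.2, ll. 269–279; proof of Lemma 3.3(a), ll. 288–296).  `iota1` is
the distinguished real place; signs are `Bool` (`true` = +). -/
structure AllowedDatum {B V : Type} (L : CharLayer B V) (Ψ : B → Bool) (iota1 : B) where
  /-- the splitting character μ_i of the datum. -/
  mu : L.Char
  /-- Def 3.2 (ll. 272–274): μ_i‖·‖^{−1/2} is algebraic of infinity type −Σ_{ρ∈Ψ_i}ρ. -/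
  mu_infty : ∀ b, InftyTypeAt Ψ (L.mExp mu) b
  /-- irreducible constituents σ of the L²-closure of π_i (bare index type). -/
  Con : Type
  /-- AX2 (l. 96): σ ↦ μ(σ), the unitary Hecke character read off σ's Satake data. -/
  muOf : Con → L.Char
  /-- AX3, base-independent step borrowed from the second proof of [Y1neg] Lemma 4.2
  (ll. 289–291, 92–94): the set of finite places where the local component σ_v is an
  unramified irreducible quotient of ω_v[χ̄′_{i,v}] (all data unramified there). -/
  UnramQuot : Con → Set V
  /-- AX3: that set contains almost all finite places ("at almost every place v all
  data are unramified and ...", l. 289). -/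
  AX3_ae : ∀ σ, L.AlmostAll (UnramQuot σ)
  /-- AX4 (+ convention pin, ll. 291–296; Kudla, MVW Ch. 5; Gan–Ichino 1409.6824
  Thm 4.4 / Atobe–Gan 1602.01299 Thm 4.3 + Prop 5.6, vendored): at such a place the
  spherical line is 1-dimensional and every unramified irreducible quotient carries
  the Satake parameter of the unramified Howe correspondent for (U(1),U(3)) with
  splitting μ_i — so μ(σ) and μ_i agree there. -/
  AX4_howe : ∀ σ, ∀ v ∈ UnramQuot σ, v ∈ L.locEq (muOf σ) mu
  /-- the real signs s_b(W_i) of the hermitian line W_i (`true` = +). -/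
  sign : B → Bool
  /-- ε_hol, the holomorphy sign at ι₁ (l. 283–285). -/
  epsHol : Bool
  /-- AX3 ([Y1neg] Lemma 3.1(a); l. 283): allowedness forces s_{ι₁}(W_i) = ε_hol
  (J⁺ occurs in the Fock model at ι₁ only for that sign). -/
  AX3_sign_iota1 : sign iota1 = epsHol
  /-- AX3 / A3(v) ([Y1neg] Lemma 3.2; S2's `mSign`): the dichotomy value m(s) — the
  exponent for which the U(3)-trivial type occurs in the Fock model of a line of
  sign s at b ≠ ι₁. -/
  mSign : Bool → ℤ
  /-- A3(v) model output (S2's `A3v_mSign_flip`): m(−s) = −m(s). -/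
  mSign_flip : ∀ s, mSign (!s) = -(mSign s)
  /-- AX3 [A#3], the HKS pin (S2's `A3v_HKS`; NOT model output): |m(s)| = 1. -/
  mSign_unit : ∀ s, mSign s = 1 ∨ mSign s = -1
  /-- AX3 occurrence (ll. 289–296 with [Y1neg] Lemma 3.2 and lem:arch(a), ll. 493–496):
  allowedness — θ(φ,χ′_i) ≠ 0 with all constituents of archimedean type J⁺⊗1 —
  forces, at each b ≠ ι₁, the trivial type to occur in the local Fock model of
  W_{i,b}, i.e. the dichotomy value of the sign of W_{i,b} to be the exponent
  m_b(μ_i). -/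
  AX3_sign_forced : ∀ b, b ≠ iota1 → mSign (sign b) = L.mExp mu b

namespace AllowedDatum

variable {B V : Type} {L : CharLayer B V} {Ψ : B → Bool} {iota1 : B}
variable (A : AllowedDatum L Ψ iota1)

/-- μ_i has the exponent pattern of Ψ_i (Def 3.2 through the A-lemma). -/
theorem mExp_mu_eq : L.mExp A.mu = mOf Ψ :=
  (inftyType_iff_mOf Ψ (L.mExp A.mu)).mp A.mu_infty
/-- The character step of Lemma 3.3(a) (ll. 289–296): μ(σ) = μ_i for every irreducible
constituent σ of the closure of π_i — AX3 (a.e. unramified quotient) + AX4 (Howe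
Satake parameter) + AX2 (rigidity). -/
theorem muOf_eq (σ : A.Con) : A.muOf σ = A.mu :=
  L.AX2_rigid _ _ (L.almostAll_mono (fun v hv => A.AX4_howe σ v hv) (A.AX3_ae σ))

/-- Constituent exponents: m_b(σ) = m_b(Ψ_i) at every complex place (the form C6's
(H2)/(H3) bookkeeping consumes). -/
theorem mExp_muOf (σ : A.Con) (b : B) : L.mExp (A.muOf σ) b = mOf Ψ b := by
  rw [A.muOf_eq σ, A.mExp_mu_eq]

/-- **Lemma 3.3(a), first clause** (ll. 281–283, 296): every irreducible constituent σ
of the closure of π_i has Φ′(σ) = Ψ_i. -/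
theorem C3a_Phiprime (σ : A.Con) : Phiprime (L.mExp (A.muOf σ)) = typeSet Ψ := by
  rw [A.muOf_eq σ, A.mExp_mu_eq]
  exact Phiprime_eq_typeSet Ψ _ fun _ => rfl

/-- The sign dichotomy is injective — from the flip law and the HKS pin alone
(m(true) ∈ {±1} and m(false) = −m(true) are distinct). -/
theorem mSign_injective : Function.Injective A.mSign := by
  intro s t h
  by_contra hne
  have hts : t = !s := by cases s <;> cases t <;> simp_all
  subst hts
  rw [A.mSign_flip s] at h
  rcases A.mSign_unit s with h1 | h1 <;> omega

/-- The inverse m^{−1} of the sign dichotomy on {±1} ([Y1neg] Lemma 3.2 notation,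
l. 283–284). -/
def mSignInv (t : ℤ) : Bool := if A.mSign true = t then true else false

/-- m ∘ m^{−1} = id on {±1} (surjectivity of the dichotomy onto {±1}). -/
theorem mSign_mSignInv (t : ℤ) (ht : t = 1 ∨ t = -1) : A.mSign (A.mSignInv t) = t := by
  have hf : A.mSign false = -(A.mSign true) := by simpa using A.mSign_flip true
  simp only [mSignInv]
  by_cases h : A.mSign true = t
  · rw [if_pos h]; exact h
  · rw [if_neg h]
    rcases A.mSign_unit true with h1 | h1 <;> rcases ht with h2 | h2 <;> omega

/-- **Lemma 3.3(a), second clause at b ≠ ι₁** (l. 283–284): the real signs of W_i are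
forced — s_b(W_i) = m^{−1}(m_b(Ψ_i)). -/
theorem C3a_sign (b : B) (hb : b ≠ iota1) : A.sign b = A.mSignInv (mOf Ψ b) := by
  apply A.mSign_injective
  rw [A.AX3_sign_forced b hb, A.mSign_mSignInv _ (mOf_unit Ψ b), A.mExp_mu_eq]

/-- **Lemma 3.3(a), second clause at ι₁** (l. 283–285): s_{ι₁}(W_i) = ε_hol. -/
theorem C3a_sign_iota1 : A.sign iota1 = A.epsHol := A.AX3_sign_iota1

/-- **Lemma 3.3(a) (lem:allowed(a)), assembled** ([PerL] ll. 280–285): every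
irreducible constituent σ of the closure of π_i has Φ′(σ) = Ψ_i, and the real signs
of W_i are forced: s_b(W_i) = m^{−1}(m_b(Ψ_i)) for b ≠ ι₁ and s_{ι₁}(W_i) = ε_hol. -/
theorem lem_allowed_a (σ : A.Con) :
    Phiprime (L.mExp (A.muOf σ)) = typeSet Ψ ∧
      (∀ b, b ≠ iota1 → A.sign b = A.mSignInv (mOf Ψ b)) ∧
      A.sign iota1 = A.epsHol :=
  ⟨A.C3a_Phiprime σ, fun b hb => A.C3a_sign b hb, A.C3a_sign_iota1⟩

end AllowedDatum

end C3a
end Perl34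

end Summit.HodgeConjecture.CorCM.Prior.Perl34File
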